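import Summits.BirchSwinnertonDyer.BirchSwinnertonDyer.Theorems.KolyvaginRankRigidityAtTwoSwapAuxClassLagrangianSignPrelims
import HarnessLib

/-!
# Crux V2♭θ `KolyvaginCorankLowerBoundAtTwoTheta` (stmt-BirchSwinnertonDyer-27220), line
# `kolyvagin_depth_split`, inside of S1, piece **P5** (auxiliary class with size) — ABSTRACT PART, II:
# the main count (helper, PROVED; seat `bsd-line-krr2-p2` g7)

See `…SwapAuxClassLagrangianSignPrelims.lean` for the setting and the mechanism.  This file proves
`exists_eigen_pow_smul_ne_zero_of_isotropic`: in a `τ`-invariant perfect pairing space `H` at `2` with a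
self-annihilating `τ`-stable `K` whose eigen-parts are lines, every `τ`-stable isotropic `A ≤ H` with
`#H ≤ #A²` has, for each sign `s`, an `s`-eigenvector of order `≥ 2^{⌊(M−7)/2⌋}` — Kolyvagin's auxiliary
class in the `ε`-part of the Selmer group relaxed at the prime being swapped out, at `p = 2`, abstractly.
HONEST FRAMING: helper (`--supports` 27220), pure group theory; S1 / V2♭θ are NOT proved; BSD is not proved.

References: [cite: Kolyvagin1991MathAnn, §2 (proof of Thm. 2.2)] [cite: Jetchev2008, Lemma 5.2]
[cite: McCallumLMS1991, §5 Prop. 5.2] [cite: MilneADT2006, Ch. I §0 Prop. 0.19].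
-/

set_option autoImplicit false
-- the Theorems namespace of this sub repeats the summit name by design (D-0017 nested layout)
set_option linter.dupNamespace false

namespace Summit.BirchSwinnertonDyer.BirchSwinnertonDyer.Theorems.KolyvaginLowerBoundAtTwo.LagrangianSign

open Function Literature.NumberTheory.GaloisCohomology

variable {H : Type*} [AddCommGroup H]

section Pairing

variable [Finite H] {M : ℕ} (hH : ∀ x : H, (2 ^ M) • x = 0)
  (b : H →+ H →+ ZMod (2 ^ M)) (hb' : Bijective b.flip)
  (τ : H →+ H) (hτ : ∀ x, τ (τ x) = x) (hbτ : ∀ x y, b (τ x) (τ y) = b x y)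
  (K : AddSubgroup H) (hKτ : ∀ x ∈ K, τ x ∈ K) (hK : ∀ x, x ∈ K ↔ ∀ y ∈ K, b y x = 0)

/-! ### The main count -/

include hH hb' hτ hbτ hKτ hK in
/-- **P5, abstract form.** In the setting of this file (`H` killed by `2^M`, `b` perfect and `τ`-invariant,
`τ² = 1`, `K = K^⊥` `τ`-stable with `#K = 2^{2M}`, `#K[2^e] ≤ 2^{2e}` and eigen-LINES
`#(K^ε ∩ K[2^e]) ≤ 2^{e+1}`), every `τ`-stable isotropic `A ≤ H` with `#H ≤ #A²` contains, for each sign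
`s = ±1`, an `s`-eigenvector `a` of `τ` with `2^{⌊(M−7)/2⌋} a ≠ 0` (`M ≥ 7`).  Steps: `#A^{−s} ≤ 2^{M+3}`
(`card_isotropic_eigen_le`), `#A ≤ #A^s · #A^{−s}` (`x ↦ x + sτx`), and `2^e A^s = 0 ⇒ #A^s ≤ 2^{2e+3}` (the key
count with `D₀ = 2^e K`).  Kolyvagin's auxiliary class of order `≥ 2^{M/2 − O(1)}` in the `ε`-part of the
Selmer group relaxed at the prime being swapped out, at `p = 2`.
[cite: Kolyvagin1991MathAnn, §2 (proof of Thm. 2.2)] [cite: Jetchev2008, Lemma 5.2] [cite: McCallumLMS1991, §5 Prop. 5.2] -/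
theorem exists_eigen_pow_smul_ne_zero_of_isotropic (hM : 7 ≤ M) (hKcard : Nat.card K = 2 ^ (2 * M))
    (hKtors : ∀ e : ℕ,
      Nat.card (K ⊓ ((2 : ℤ) ^ e • AddMonoidHom.id H).ker : AddSubgroup H) ≤ 2 ^ (2 * e))
    (hKline : ∀ ε : ℤ, ε = 1 ∨ ε = -1 → ∀ e : ℕ,
      Nat.card (K ⊓ (τ - ε • AddMonoidHom.id H).ker ⊓ ((2 : ℤ) ^ e • AddMonoidHom.id H).ker :
        AddSubgroup H) ≤ 2 ^ (e + 1))
    (A : AddSubgroup H) (hAτ : ∀ x ∈ A, τ x ∈ A) (hAA : ∀ x ∈ A, ∀ y ∈ A, b x y = 0)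
    (hA : Nat.card H ≤ Nat.card A * Nat.card A) {s : ℤ} (hs : s = 1 ∨ s = -1) :
    ∃ a ∈ A, τ a = s • a ∧ (2 : ℤ) ^ ((M - 7) / 2) • a ≠ 0 := by
  classical
  set e := (M - 7) / 2 with he
  have he2 : 2 * e + 7 ≤ M := by omega
  have hs2 : s * s = 1 := by rcases hs with rfl | rfl <;> norm_num
  have hε : (-s) = 1 ∨ (-s) = -1 := by rcases hs with rfl | rfl <;> simp
  have hH' : ∀ x : H, (2 : ℤ) ^ M • x = 0 := fun x => by
    have h := hH x
    rwa [← natCast_zsmul, Nat.cast_pow, Nat.cast_ofNat] at h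
  have hmem_eig : ∀ (ε : ℤ) (x : H), x ∈ (τ - ε • AddMonoidHom.id H).ker ↔ τ x = ε • x := fun ε x => by
    rw [AddMonoidHom.mem_ker, AddMonoidHom.sub_apply, AddMonoidHom.smul_apply, AddMonoidHom.id_apply,
      sub_eq_zero]
  have hmem_tor : ∀ (c : ℤ) (x : H), x ∈ (c • AddMonoidHom.id H).ker ↔ c • x = 0 := fun c x => by
    rw [AddMonoidHom.mem_ker, AddMonoidHom.smul_apply, AddMonoidHom.id_apply]
  -- `#K^ε ≤ 2^(M+1)`
  have hKeig : ∀ ε : ℤ, ε = 1 ∨ ε = -1 →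
      Nat.card (K ⊓ (τ - ε • AddMonoidHom.id H).ker : AddSubgroup H) ≤ 2 ^ (M + 1) := by
    intro ε hε'
    have hle : (K ⊓ (τ - ε • AddMonoidHom.id H).ker : AddSubgroup H) ≤
        K ⊓ (τ - ε • AddMonoidHom.id H).ker ⊓ ((2 : ℤ) ^ M • AddMonoidHom.id H).ker :=
      fun x hx => AddSubgroup.mem_inf.mpr ⟨hx, (hmem_tor _ x).mpr (hH' x)⟩
    exact (Nat.card_le_card_of_injective _ (AddSubgroup.inclusion_injective hle)).trans (hKline ε hε' M)
  -- the two eigen-parts of `A`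
  set Ap : AddSubgroup H := A ⊓ (τ - s • AddMonoidHom.id H).ker with hAp
  set Am : AddSubgroup H := A ⊓ (τ - (-s) • AddMonoidHom.id H).ker with hAm
  have hAp_eig : ∀ x ∈ Ap, τ x = s • x := fun x hx => (hmem_eig _ x).mp (AddSubgroup.mem_inf.mp hx).2
  have hAm_eig : ∀ x ∈ Am, τ x = (-s) • x := fun x hx => (hmem_eig _ x).mp (AddSubgroup.mem_inf.mp hx).2
  have hAm_iso : ∀ x ∈ Am, ∀ y ∈ Am, b x y = 0 := fun x hx y hy =>
    hAA x (AddSubgroup.mem_inf.mp hx).1 y (AddSubgroup.mem_inf.mp hy).1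
  -- (1) `#A^{-s} ≤ 2^(M+3)`
  have h1 : Nat.card Am ≤ 2 ^ (M + 3) := by
    have h := card_isotropic_eigen_le hH b hb' τ hτ hbτ K hKτ hK (-s) hε Am hAm_eig hAm_iso
    have hK2 : Nat.card (K ⊓ ((2 : ℤ) • AddMonoidHom.id H).ker : AddSubgroup H) ≤ 2 ^ 2 := by
      have h2 := hKtors 1
      rwa [pow_one, mul_one] at h2
    calc Nat.card Am ≤ _ := h
      _ ≤ 2 ^ (M + 1) * 2 ^ 2 := Nat.mul_le_mul (hKeig (-s) hε) hK2
      _ = 2 ^ (M + 3) := by rw [← pow_add]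
  -- (2) `#A ≤ #A^s · #A^{-s}` through `x ↦ x + s τ x`
  set φ : H →+ H := AddMonoidHom.id H + s • τ with hφ
  have hφapply : ∀ x, φ x = x + s • τ x := fun x => rfl
  have h2 : Nat.card A ≤ Nat.card Ap * Nat.card Am := by
    have hsplit := card_map_mul_card_inf_ker φ A
    have hmap : A.map φ ≤ Ap := by
      rintro _ ⟨x, hx, rfl⟩
      refine AddSubgroup.mem_inf.mpr ⟨?_, (hmem_eig s _).mpr ?_⟩
      · rw [hφapply]; exact A.add_mem hx (A.zsmul_mem (hAτ x hx) s)
      · rw [hφapply, map_add, map_zsmul, hτ, smul_add, smul_smul, hs2, one_smul, add_comm]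
    have hker : (A ⊓ φ.ker : AddSubgroup H) ≤ Am := by
      intro x hx
      obtain ⟨hxA, hxk⟩ := AddSubgroup.mem_inf.mp hx
      refine AddSubgroup.mem_inf.mpr ⟨hxA, (hmem_eig _ x).mpr ?_⟩
      rw [AddMonoidHom.mem_ker, hφapply] at hxk
      have h3 : s • τ x = -x := eq_neg_of_add_eq_zero_right hxk
      calc τ x = (s * s) • τ x := by rw [hs2, one_smul]
        _ = s • (s • τ x) := mul_smul _ _ _
        _ = s • (-x) := by rw [h3]
        _ = (-s) • x := by rw [smul_neg, neg_smul]
    calc Nat.card A = Nat.card (A.map φ) * Nat.card (A ⊓ φ.ker : AddSubgroup H) := hsplit.symm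
      _ ≤ Nat.card Ap * Nat.card Am :=
          Nat.mul_le_mul (Nat.card_le_card_of_injective _ (AddSubgroup.inclusion_injective hmap))
            (Nat.card_le_card_of_injective _ (AddSubgroup.inclusion_injective hker))
  -- (3) if `2^e` killed `A^s`, then `#A^s ≤ 2^(2e+3)`
  by_contra hcon
  push Not at hcon
  have hApkill : ∀ x ∈ Ap, (2 : ℤ) ^ e • x = 0 := fun x hx =>
    hcon x (AddSubgroup.mem_inf.mp hx).1 (hAp_eig x hx)
  set D₀ : AddSubgroup H := K.map ((2 : ℤ) ^ e • AddMonoidHom.id H) with hD₀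
  have hD₀K : D₀ ≤ K := by
    rintro _ ⟨k, hk, rfl⟩
    rw [AddMonoidHom.smul_apply, AddMonoidHom.id_apply]
    exact K.zsmul_mem hk _
  have hTD : ∀ d ∈ D₀, ∀ x ∈ Ap, b d x = 0 := by
    rintro _ ⟨k, -, rfl⟩ x hx
    rw [AddMonoidHom.smul_apply, AddMonoidHom.id_apply, map_zsmul, AddMonoidHom.smul_apply, ← map_zsmul,
      hApkill x hx, map_zero]
  have hkey := card_mul_card_sup_le hH b hb' τ hτ hbτ K hKτ hK s Ap hAp_eig D₀ hD₀K hTD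
  set R : AddSubgroup H := K.map (τ - s • AddMonoidHom.id H) with hR
  -- `#(A^s ∩ K) ≤ 2^(e+1)`
  have hApK : Nat.card (Ap ⊓ K : AddSubgroup H) ≤ 2 ^ (e + 1) := by
    have hle : (Ap ⊓ K : AddSubgroup H) ≤
        K ⊓ (τ - s • AddMonoidHom.id H).ker ⊓ ((2 : ℤ) ^ e • AddMonoidHom.id H).ker := by
      intro x hx
      obtain ⟨hxAp, hxK⟩ := AddSubgroup.mem_inf.mp hx
      exact AddSubgroup.mem_inf.mpr ⟨AddSubgroup.mem_inf.mpr ⟨hxK, (AddSubgroup.mem_inf.mp hxAp).2⟩,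
        (hmem_tor _ x).mpr (hApkill x hxAp)⟩
    exact (Nat.card_le_card_of_injective _ (AddSubgroup.inclusion_injective hle)).trans (hKline s hs e)
  -- `#(R ⊔ D₀) · #(R ⊓ D₀) = #R · #D₀`, `#(R ⊓ D₀) ≤ 2^(M-e+1)`
  have hsup := card_sup_mul_card_inf R D₀
  have hRD : Nat.card (R ⊓ D₀ : AddSubgroup H) ≤ 2 ^ (M - e + 1) := by
    have hle : (R ⊓ D₀ : AddSubgroup H) ≤
        K ⊓ (τ - (-s) • AddMonoidHom.id H).ker ⊓ ((2 : ℤ) ^ (M - e) • AddMonoidHom.id H).ker := by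
      intro x hx
      obtain ⟨hxR, hxD⟩ := AddSubgroup.mem_inf.mp hx
      obtain ⟨k, -, hkx⟩ := AddSubgroup.mem_map.mp hxR
      obtain ⟨k', -, hk'x⟩ := AddSubgroup.mem_map.mp hxD
      refine AddSubgroup.mem_inf.mpr ⟨AddSubgroup.mem_inf.mpr ⟨hD₀K hxD, (hmem_eig _ x).mpr ?_⟩,
        (hmem_tor _ x).mpr ?_⟩
      · rw [← hkx]; exact tau_sub_smul_eq_neg τ hτ s hs k
      · rw [← hk'x, AddMonoidHom.smul_apply, AddMonoidHom.id_apply, smul_smul, ← pow_add,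
          show M - e + e = M by omega]
        exact hH' k'
    exact (Nat.card_le_card_of_injective _ (AddSubgroup.inclusion_injective hle)).trans
      (hKline (-s) hε (M - e))
  -- `#R · #K^s = #K`, `#D₀ · #K[2^e] = #K`
  have hRK : Nat.card R * Nat.card (K ⊓ (τ - s • AddMonoidHom.id H).ker : AddSubgroup H) =
      Nat.card K := card_map_mul_card_inf_ker _ K
  have hDK : Nat.card D₀ * Nat.card (K ⊓ ((2 : ℤ) ^ e • AddMonoidHom.id H).ker : AddSubgroup H) =
      Nat.card K := card_map_mul_card_inf_ker _ K
  -- assembly: `#A^s · #K ≤ #(A^s ∩ K) · #(R ⊓ D₀) · #K^s · #K[2^e] ≤ 2^(2M+2e+3)`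
  have h3 : Nat.card Ap ≤ 2 ^ (2 * e + 3) := by
    have hKpos : 0 < Nat.card K := Nat.card_pos
    have hprod : Nat.card Ap * Nat.card K * Nat.card K ≤
        Nat.card K * (Nat.card (Ap ⊓ K : AddSubgroup H) * Nat.card (R ⊓ D₀ : AddSubgroup H) *
          Nat.card (K ⊓ (τ - s • AddMonoidHom.id H).ker : AddSubgroup H) *
          Nat.card (K ⊓ ((2 : ℤ) ^ e • AddMonoidHom.id H).ker : AddSubgroup H)) := by
      calc Nat.card Ap * Nat.card K * Nat.card K
          = Nat.card Ap * (Nat.card R * Nat.card (K ⊓ (τ - s • AddMonoidHom.id H).ker : AddSubgroup H)) *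
              (Nat.card D₀ * Nat.card (K ⊓ ((2 : ℤ) ^ e • AddMonoidHom.id H).ker : AddSubgroup H)) := by
            rw [hRK, hDK]
        _ = Nat.card Ap * (Nat.card (R ⊔ D₀ : AddSubgroup H) * Nat.card (R ⊓ D₀ : AddSubgroup H)) *
              (Nat.card (K ⊓ (τ - s • AddMonoidHom.id H).ker : AddSubgroup H) *
                Nat.card (K ⊓ ((2 : ℤ) ^ e • AddMonoidHom.id H).ker : AddSubgroup H)) := by
            rw [hsup]; ring
        _ = (Nat.card Ap * Nat.card (R ⊔ D₀ : AddSubgroup H)) * (Nat.card (R ⊓ D₀ : AddSubgroup H) *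
              (Nat.card (K ⊓ (τ - s • AddMonoidHom.id H).ker : AddSubgroup H) *
                Nat.card (K ⊓ ((2 : ℤ) ^ e • AddMonoidHom.id H).ker : AddSubgroup H))) := by ring
        _ ≤ (Nat.card K * Nat.card (Ap ⊓ K : AddSubgroup H)) * (Nat.card (R ⊓ D₀ : AddSubgroup H) *
              (Nat.card (K ⊓ (τ - s • AddMonoidHom.id H).ker : AddSubgroup H) *
                Nat.card (K ⊓ ((2 : ℤ) ^ e • AddMonoidHom.id H).ker : AddSubgroup H))) :=
            Nat.mul_le_mul_right _ hkey
        _ = _ := by ring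
    have h4 : Nat.card Ap * Nat.card K ≤
        Nat.card (Ap ⊓ K : AddSubgroup H) * Nat.card (R ⊓ D₀ : AddSubgroup H) *
          Nat.card (K ⊓ (τ - s • AddMonoidHom.id H).ker : AddSubgroup H) *
          Nat.card (K ⊓ ((2 : ℤ) ^ e • AddMonoidHom.id H).ker : AddSubgroup H) := by
      rw [mul_comm (Nat.card K) _] at hprod
      exact Nat.le_of_mul_le_mul_right hprod hKpos
    have h5 : Nat.card Ap * 2 ^ (2 * M) ≤ 2 ^ (2 * e + 3) * 2 ^ (2 * M) := by
      calc Nat.card Ap * 2 ^ (2 * M) = Nat.card Ap * Nat.card K := by rw [hKcard]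
        _ ≤ _ := h4
        _ ≤ 2 ^ (e + 1) * 2 ^ (M - e + 1) * 2 ^ (M + 1) * 2 ^ (2 * e) :=
            Nat.mul_le_mul (Nat.mul_le_mul (Nat.mul_le_mul hApK hRD) (hKeig s hs)) (hKtors e)
        _ = 2 ^ (2 * e + 3) * 2 ^ (2 * M) := by
            rw [← pow_add, ← pow_add, ← pow_add, ← pow_add]; congr 1; omega
    exact Nat.le_of_mul_le_mul_right h5 (by positivity)
  -- contradiction with `#H ≤ #A²`, `#H = #K² = 2^(4M)`
  have hHcard : Nat.card H = 2 ^ (2 * M) * 2 ^ (2 * M) := by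
    rw [← card_mul_card_eq_of_selfAnnihilating hH b hb' K hK, hKcard]
  have h6 : Nat.card A ≤ 2 ^ (2 * e + 3) * 2 ^ (M + 3) := h2.trans (Nat.mul_le_mul h3 h1)
  have h7 : 2 ^ (2 * M) * 2 ^ (2 * M) ≤ (2 ^ (2 * e + 3) * 2 ^ (M + 3)) * (2 ^ (2 * e + 3) * 2 ^ (M + 3)) := by
    rw [← hHcard]; exact hA.trans (Nat.mul_le_mul h6 h6)
  simp only [← pow_add] at h7
  have h8 := (Nat.pow_le_pow_iff_right (by norm_num : 1 < 2)).mp h7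
  omega

end Pairing

end Summit.BirchSwinnertonDyer.BirchSwinnertonDyer.Theorems.KolyvaginLowerBoundAtTwo.LagrangianSign
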